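import Literature.NumberTheory.IwasawaTheory.Greenberg2006.CoinducedModuleDual
import Literature.NumberTheory.EllipticCurves.AnticyclotomicBigGaloisRep
import Mathlib.LinearAlgebra.Matrix.ToLinearEquiv
import Mathlib.Algebra.Polynomial.Degree.Lemmas
import HarnessLib

/-!
# T-42-mult in the kernel, XLV — P49-KERNEL (3): Greenberg's local hypothesis LOC_v⁽¹⁾ `(T*)^{G_{K_v}} = 0` for the
# co-induced module `𝒜 = A ⊗ Λ^*(κ̄⁻¹)` at every place where the `ℤ_p`-tower does NOT split completely — the
# DETERMINANT argument (input (I2) of `P49Kernel.prop49_of_kernelInputs`, and LOC_v⁽²⁾ at the finite places)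

Cell `bsd-2adic` (run/shared/lean/pub/bsd-2adic/), seat `bsd-2adic-t42` GEN 18 (pen RC-315 (b); memo
`t42/DESIGN-T42-ADDENDUM-21` §A21.3 (I2)). HONEST FRAMING: research route; THEOREMS ONLY (no `def`, no named fact, no
instance, no `sorry`); nothing booked; BSD is not proved by any of this. PARTITION: X5@2 multiplicative GV-transport rows
(K4ᵐ B1·O1; PRINT binder P49 of `multCongruenceTransportAtTwo_of_print49`) × p = 2 — reduces-the-named-input-of; bears_on K4
19922 / 19923 (`--supports stmt-BirchSwinnertonDyer-19923`).

PRINT (Greenberg, Doc. Math. 2006, p. 342 L35–36, on `𝒟 = Ind_{K_∞/K}(D)`, `T* = Hom(𝒟, μ_{p^∞})`): "For any `v` which does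
not split completely, one sees easily that `(T*)^{G_{K_v}} = 0`." (= Greenberg 2010 Lemma 5.2.2: "Suppose that `v ∈ Σ` and
that the decomposition subgroup of `Γ` for `v` is nontrivial. Then `H⁰(K_v, T*) = 0`"; Greenberg 2016 §4.3 p. 20 L26–30).
The tree's `twistDeformation_LOC1_of_ne_one` (`CoinducedModuleDual.lean`) proves this from an element `σ` acting TRIVIALLY
on `D` and on `μ_{p^∞}` with `κ(σ) ≠ 0` — unavailable for the cyclotomic deformation of `E[p^∞]`
(`ℚ_p(E[p^∞]) ⊇ ℚ_p(μ_{p^∞}) ⊇ ℚ_{p,∞}`). This file proves the printed statement IN FULL, for ANY `σ ∈ Γ_{K_v}` with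
`κ̄(σ) ≠ 0`, by Greenberg's "one sees easily": in the free Tate dual `T* ≅ Y_A⟦T⟧` (structure theorem
`BigRepModule.isDualPairing_seriesToDual`) the `σ`-equivariance of `f = ⟨F, ·⟩` reads `((1+T)^{−c}·B − U) F = 0`, where
`c = κ̄(σ)`, `B` is the adjoint of `ρ₀(σ)` on `Y_A` and `U` the (invertible) adjoint of `σ` on the values `K̄ˣ`; and
`det((1+T)^{−c}B − U) ≠ 0` in the domain `Λ`: the polynomial `d(w) = det(wB − U)` has `d(0) = ±det U ≠ 0`, and substituting
`w = (1+T)^{−c} = 1 + T·g`, `g(0) = −c ≠ 0`, the lowest coefficient of `d(1 + Tg) = e(Tg)` (`e(w) = d(w+1) ≠ 0`) is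
`e_{k₀}(−c)^{k₀} ≠ 0`.

* §1 `exists_adjoint`, `exists_valueAdjoint` — adjoints on a Tate dual `(Y_A, t_A)` of `A` (`t_A` bijective onto `Hom(A, K̄ˣ)`).
* §2 `seriesToDual_mapRange`, `units_seriesToDual` — how `⟨F, ·⟩` sees `ρ₀(σ)` (coefficientwise `B`, matrix
  `LinearMap.toMatrix b_A b_A B` over `Λ` through `C`) and the value action (coefficientwise `U`); `localRep_bigRep_eq` —
  `σ` acts on `𝒜` as `ρ₀(σ)_* ∘ (1+T)^{−c}` (`translate_eq_binomSeries_smul`).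
* §3 `eval₂_ne_zero_of_constantCoeff_eq_one` — a non-zero `d ∈ ℤ_p[w]` does not vanish at a `u ∈ Λ` with `u(0) = 1`,
  `u'(0) ≠ 0` (lowest-order term).
* §4 **`loc1_bigRep_of_kappa_ne_one`** — LOC_v⁽¹⁾ for `bigRep κ̄ ρ₀` at `v` from ONE `σ ∈ Γ_{K_v}` with `κ̄(σ) ≠ 1`, for any
  `p`-primary `A` with a Tate dual free of finite rank over `ℤ_p`.

References: [Greenberg2006] p. 342 L35–36; [Greenberg2010] Lemma 5.2.2; [Greenberg2016Selmer] §2.1 p. 6, §4.3 p. 20;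
[CoatesSujatha2006Cyclotomic] §3.3 (Mahler basis, `γ^c ↦ (1+T)^c`).
-/

set_option autoImplicit false
set_option linter.dupNamespace false

noncomputable section

open scoped Classical Matrix

namespace Summit.BirchSwinnertonDyer.BirchSwinnertonDyer.Theorems.P49Kernel

open NumberField IsDedekindDomain Field Finset Polynomial
  Literature.NumberTheory.EllipticCurves Literature.NumberTheory.EllipticCurves.BigRepModule
  Literature.NumberTheory.GaloisRepresentations
  Literature.NumberTheory.IwasawaTheory.Greenberg2006 Literature.NumberTheory.IwasawaTheory.Greenberg2016

variable {K : Type} [Field K] [NumberField K] {S : Set (HeightOneSpectrum (𝓞 K))} {p : ℕ} [Fact p.Prime]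
  {A : Type} [AddCommGroup A] [Module ℤ_[p] A] [TopologicalSpace A] [DiscreteTopology A]
  {YA : Type} [AddCommGroup YA] [Module ℤ_[p] YA]
  {tA : YA →+ (A →+ DiscreteGaloisModule.UnitsCarrier K)} (hYA : IsDualPairing ℤ_[p] A tA)
  {n : ℕ} (bA : Module.Basis (Fin n) ℤ_[p] YA)

/-! ## §1. Adjoints on a Tate dual of `A` -/

section Adjoint

include hYA

omit [NumberField K] [TopologicalSpace A] [DiscreteTopology A] in
/-- The ADJOINT of a `ℤ_p`-linear `L : A → A` on the Tate dual: `t_A (B y) a = t_A y (L a)`.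
[cite: Greenberg2006, p. 342 L35–36] -/
theorem exists_adjoint (L : A →ₗ[ℤ_[p]] A) :
    ∃ B : YA →ₗ[ℤ_[p]] YA, ∀ (y : YA) (a : A), tA (B y) a = tA y (L a) := by
  let B₀ : YA →+ YA :=
    (hYA.addEquiv.symm.toAddMonoidHom).comp
      { toFun := fun y ↦ (tA y).comp L.toAddMonoidHom
        map_zero' := by ext; simp
        map_add' := fun _ _ ↦ by ext; simp }
  have hB₀ : ∀ y a, tA (B₀ y) a = tA y (L a) := fun y a ↦ by
    change tA (hYA.addEquiv.symm ((tA y).comp L.toAddMonoidHom)) a = _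
    rw [hYA.apply_addEquiv_symm]
    rfl
  refine ⟨{ toFun := B₀, map_add' := B₀.map_add, map_smul' := fun r y ↦ hYA.injective ?_ }, hB₀⟩
  ext a
  rw [hB₀, RingHom.id_apply, hYA.map_smul, hYA.map_smul, hB₀, L.map_smul]

omit [NumberField K] [TopologicalSpace A] [DiscreteTopology A] in
/-- The ADJOINT of the action of `g ∈ Γ_K` on the VALUES `K̄ˣ`: `t_A (U y) a = g · (t_A y a)`; it is injective (`g` acts
bijectively on `K̄ˣ`). [cite: Greenberg2006, p. 342 L35–36] -/
theorem exists_valueAdjoint (g : absoluteGaloisGroup K) :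
    ∃ U : YA →ₗ[ℤ_[p]] YA, (∀ (y : YA) (a : A), tA (U y) a = DiscreteGaloisModule.units K g (tA y a)) ∧
      Function.Injective U := by
  let U₀ : YA →+ YA :=
    (hYA.addEquiv.symm.toAddMonoidHom).comp
      { toFun := fun y ↦ (DiscreteGaloisModule.units K g).toAddMonoidHom.comp (tA y)
        map_zero' := by ext; simp
        map_add' := fun _ _ ↦ by ext; simp }
  have hU₀ : ∀ y a, tA (U₀ y) a = DiscreteGaloisModule.units K g (tA y a) := fun y a ↦ by
    change tA (hYA.addEquiv.symm ((DiscreteGaloisModule.units K g).toAddMonoidHom.comp (tA y))) a = _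
    rw [hYA.apply_addEquiv_symm]
    rfl
  refine ⟨{ toFun := U₀, map_add' := U₀.map_add, map_smul' := fun r y ↦ hYA.injective ?_ }, hU₀, ?_⟩
  · ext a
    rw [hU₀, RingHom.id_apply, hYA.map_smul, hYA.map_smul, hU₀]
  · intro y y' h
    apply hYA.injective
    ext a
    have h1 := hU₀ y a
    have h2 := hU₀ y' a
    change tA (U₀ y) a = _ at h1
    change tA (U₀ y') a = _ at h2
    have : U₀ y = U₀ y' := h
    rw [this] at h1
    have hinj : Function.Injective (DiscreteGaloisModule.units K g) := fun w w' hw ↦ by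
      have := congrArg (DiscreteGaloisModule.units K g⁻¹) hw
      rwa [← Module.End.mul_apply, ← map_mul, inv_mul_cancel, map_one, Module.End.one_apply,
        ← Module.End.mul_apply, ← map_mul, inv_mul_cancel, map_one, Module.End.one_apply] at this
    exact hinj (h1.symm.trans h2)

end Adjoint

/-! ## §2. The model pairing against `ρ₀(σ)_*`, against the value action, and the action of `σ` on `𝒜` -/

section Model

variable [TopologicalSpace (PowerSeries ℤ_[p])]
  (κbar : GaloisGroupUnramifiedOutside K S →ₜ* Multiplicative ℤ_[p])
  (ρ₀ : ContinuousRep (GaloisGroupUnramifiedOutside K S) ℤ_[p] A)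
  (hA : ∀ a : A, ∃ k : ℕ, p ^ k • a = 0)

/-- `σ` acts on `𝒜` as `ρ₀(σ)_* ∘ τ_{−c} = ρ₀(σ)_* ∘ (1+T)^{−c}`, `c = κ̄(σ)`. [cite: Greenberg2006, p. 342 L5 (ρ = ρ₀ ⊗ κ^{-1})]
[cite: CoatesSujatha2006Cyclotomic, Lemma 3.3.4 (§3.3 p. 37)] -/
theorem localRep_bigRep_eq (v : Place K) (σ : absoluteGaloisGroup v.Completion) (Φ : BigRepModule ℤ_[p] p A) :
    localRep S (bigRep κbar ρ₀) v σ Φ =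
      mapRange (ρ₀ (localToUnramified S v σ))
        (binomSeries ℤ_[p] (-(κbar (localToUnramified S v σ)).toAdd) • Φ) := by
  rw [← translate_eq_binomSeries_smul]
  ext x
  rw [localRep_apply, bigRep_apply_apply, mapRange_apply, translate_apply, sub_eq_add_neg]

omit [TopologicalSpace (PowerSeries ℤ_[p])] in
/-- Coefficientwise action of a `ℤ_p`-matrix (pushed to `Λ` through `C`) on `Y_A⟦T⟧ ≅ (Fin n → Λ)`: the `i`-th
coefficient vector of `M_* F` is `M` applied to that of `F` (in the basis `b_A`). [cite: Greenberg2006, p. 342 L4–11 (𝒯 = T ⊗ Λ)] -/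
theorem seriesCoeff_map_mulVec (M : Matrix (Fin n) (Fin n) ℤ_[p]) (F : Fin n → PowerSeries ℤ_[p]) (i : ℕ) :
    seriesCoeff bA ((M.map (PowerSeries.C (R := ℤ_[p]))) *ᵥ F) i = Matrix.toLin bA bA M (seriesCoeff bA F i) := by
  have hcoeff : ∀ k, PowerSeries.coeff i (((M.map (PowerSeries.C (R := ℤ_[p]))) *ᵥ F) k) =
      (M *ᵥ fun j ↦ PowerSeries.coeff i (F j)) k := fun k ↦ by
    simp only [Matrix.mulVec, dotProduct, Matrix.map_apply, map_sum, PowerSeries.coeff_C_mul]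
  have h1 : seriesCoeff bA F i = bA.equivFun.symm fun j ↦ PowerSeries.coeff i (F j) := by
    rw [bA.equivFun_symm_apply]; rfl
  have h2 : ⇑(bA.repr (bA.equivFun.symm fun j ↦ PowerSeries.coeff i (F j))) = fun j ↦ PowerSeries.coeff i (F j) := by
    funext j; rw [← bA.equivFun_apply, LinearEquiv.apply_symm_apply]
  rw [h1, Matrix.toLin_apply, h2]
  exact Finset.sum_congr rfl fun k _ ↦ by rw [hcoeff]

omit [NumberField K] [TopologicalSpace A] [DiscreteTopology A] [TopologicalSpace (PowerSeries ℤ_[p])] in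
/-- **`⟨F, L_* Ψ⟩ = ⟨B_* F, Ψ⟩`** with `B` the adjoint of `L` and `B_*` coefficientwise (the matrix of `B` in the basis `b_A`,
pushed to `Λ` through `C`). [cite: Greenberg2006, p. 342 L4–11, L35–36] -/
theorem seriesToDual_mapRange (L : A →ₗ[ℤ_[p]] A) {B : YA →ₗ[ℤ_[p]] YA}
    (hB : ∀ (y : YA) (a : A), tA (B y) a = tA y (L a)) (F : Fin n → PowerSeries ℤ_[p])
    (Ψ : BigRepModule ℤ_[p] p A) :
    seriesToDual tA bA F (mapRange L Ψ) =
      seriesToDual tA bA (((LinearMap.toMatrix bA bA B).map (PowerSeries.C (R := ℤ_[p]))) *ᵥ F) Ψ := by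
  have hN := nilIndex_spec Ψ
  have hNL : ((shiftSubOne : BigRepModule ℤ_[p] p A →ₗ[ℤ_[p]] _) ^ nilIndex Ψ) (mapRange L Ψ) = 0 := by
    rw [shiftSubOne_pow_eq_X_pow_smul, ← mapRange_powerSeries_smul, ← shiftSubOne_pow_eq_X_pow_smul, hN, map_zero]
  rw [seriesToDual_apply tA bA F hNL, seriesToDual_apply tA bA _ hN]
  refine Finset.sum_congr rfl fun i _ ↦ ?_
  rw [shiftSubOne_pow_eq_X_pow_smul, ← mapRange_powerSeries_smul, ← shiftSubOne_pow_eq_X_pow_smul, mapRange_apply,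
    ← hB, seriesCoeff_map_mulVec bA, Matrix.toLin_toMatrix]

omit [NumberField K] [TopologicalSpace A] [DiscreteTopology A] [TopologicalSpace (PowerSeries ℤ_[p])] in
/-- **`g · ⟨F, Φ⟩ = ⟨U_* F, Φ⟩`** with `U` the adjoint of the value action of `g`. [cite: Greenberg2006, p. 342 L35–36] -/
theorem units_seriesToDual (g : absoluteGaloisGroup K) {U : YA →ₗ[ℤ_[p]] YA}
    (hU : ∀ (y : YA) (a : A), tA (U y) a = DiscreteGaloisModule.units K g (tA y a))
    (F : Fin n → PowerSeries ℤ_[p]) (Φ : BigRepModule ℤ_[p] p A) :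
    DiscreteGaloisModule.units K g (seriesToDual tA bA F Φ) =
      seriesToDual tA bA (((LinearMap.toMatrix bA bA U).map (PowerSeries.C (R := ℤ_[p]))) *ᵥ F) Φ := by
  have hN := nilIndex_spec Φ
  rw [seriesToDual_apply tA bA F hN, seriesToDual_apply tA bA _ hN, map_sum]
  refine Finset.sum_congr rfl fun i _ ↦ ?_
  rw [← hU, seriesCoeff_map_mulVec bA, Matrix.toLin_toMatrix]

end Model

/-! ## §3. The lowest-order-term lemma: `d((1+T)^{-c}) ≠ 0` -/

section LowestOrder

/-- **A non-zero polynomial over `ℤ_p` does not vanish at `u ∈ Λ = ℤ_p⟦T⟧` with `u(0) = 1` and `u'(0) ≠ 0`**: with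
`e(w) = d(w + 1) ≠ 0`, `t = u − 1 = T·g`, `g(0) = u'(0)`, the coefficient of `T^{k₀}` in `e(Tg)` (`k₀` the trailing degree
of `e`) is `e_{k₀} · g(0)^{k₀} ≠ 0`. [cite: Greenberg2006, p. 342 L35–36 ("one sees easily")] -/
theorem eval₂_ne_zero_of_constantCoeff_eq_one {d : ℤ_[p][X]} (hd : d ≠ 0) {u : PowerSeries ℤ_[p]}
    (hu0 : PowerSeries.constantCoeff u = 1) (hu1 : PowerSeries.coeff 1 u ≠ 0) :
    Polynomial.eval₂ (PowerSeries.C (R := ℤ_[p])) u d ≠ 0 := by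
  -- shift: `e(w) = d(w + 1)`, `t = u - 1`
  set e : ℤ_[p][X] := d.comp (X + C 1) with he
  set t : PowerSeries ℤ_[p] := u - 1 with ht
  have heval : Polynomial.eval₂ (PowerSeries.C (R := ℤ_[p])) u d = Polynomial.eval₂ (PowerSeries.C (R := ℤ_[p])) t e := by
    rw [he, Polynomial.eval₂_comp, Polynomial.eval₂_add, Polynomial.eval₂_X, Polynomial.eval₂_C, ht, map_one,
      sub_add_cancel]
  have he0 : e ≠ 0 := by
    intro h0
    rcases Polynomial.comp_eq_zero_iff.mp h0 with h | ⟨-, h⟩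
    · exact hd h
    · have := congrArg (Polynomial.coeff · 1) h
      simp at this
  -- `t = T · g` with `g(0) = u'(0)`
  set g : PowerSeries ℤ_[p] := PowerSeries.mk fun i ↦ PowerSeries.coeff (i + 1) t with hg
  have htg : t = PowerSeries.X * g := by
    have h := PowerSeries.eq_X_mul_shift_add_const t
    have ht0 : PowerSeries.constantCoeff t = 0 := by rw [ht, map_sub, hu0, map_one, sub_self]
    rw [ht0, map_zero, add_zero] at h
    exact h
  have hg0 : PowerSeries.constantCoeff g = PowerSeries.coeff 1 u := by
    rw [hg, ← PowerSeries.coeff_zero_eq_constantCoeff_apply, PowerSeries.coeff_mk, zero_add, ht, map_sub,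
      PowerSeries.coeff_one, if_neg one_ne_zero, sub_zero]
  -- the coefficient of `T^{k₀}`
  set k₀ := e.natTrailingDegree with hk₀
  have hcoeff : PowerSeries.coeff k₀ (Polynomial.eval₂ (PowerSeries.C (R := ℤ_[p])) t e) =
      e.trailingCoeff * (PowerSeries.coeff 1 u) ^ k₀ := by
    rw [Polynomial.eval₂_eq_sum_range, map_sum]
    rw [Finset.sum_eq_single k₀]
    · rw [PowerSeries.coeff_C_mul, htg, mul_pow, PowerSeries.coeff_X_pow_mul', if_pos le_rfl, Nat.sub_self,
        PowerSeries.coeff_zero_eq_constantCoeff_apply, map_pow, hg0]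
      rfl
    · intro i _ hi
      rcases lt_or_gt_of_ne hi with h | h
      · rw [Polynomial.coeff_eq_zero_of_lt_natTrailingDegree h, map_zero, zero_mul, map_zero]
      · rw [PowerSeries.coeff_C_mul, htg, mul_pow, PowerSeries.coeff_X_pow_mul', if_neg (not_le.mpr h), mul_zero]
    · intro hk
      have : e.coeff k₀ = 0 := by
        rw [Finset.mem_range, not_lt] at hk
        exact Polynomial.coeff_eq_zero_of_natDegree_lt (by omega)
      rw [this, map_zero, zero_mul, map_zero]
  intro h0
  rw [heval] at h0
  rw [h0, map_zero] at hcoeff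
  exact (mul_ne_zero (Polynomial.trailingCoeff_nonzero_iff_nonzero.mpr he0) (pow_ne_zero _ hu1)) hcoeff.symm

end LowestOrder

/-! ## §4. LOC_v⁽¹⁾ from one `σ` with `κ̄(σ) ≠ 1` -/

section LOC1

variable [TopologicalSpace (PowerSeries ℤ_[p])]
  (κbar : GaloisGroupUnramifiedOutside K S →ₜ* Multiplicative ℤ_[p])
  (ρ₀ : ContinuousRep (GaloisGroupUnramifiedOutside K S) ℤ_[p] A)
  (hA : ∀ a : A, ∃ k : ℕ, p ^ k • a = 0)

include hYA bA hA

/-- **LOC_v⁽¹⁾(`𝒜`) from ONE `σ ∈ Γ_{K_v}` with `κ̄(σ) ≠ 1`** ("for any `v` which does not split completely,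
`(T*)^{G_{K_v}} = 0`"), for `𝒜 = bigRep κ̄ ρ₀`, `A` `p`-primary with a Tate dual free of rank `n` over `ℤ_p`: the
determinant argument of the module docstring. [cite: Greenberg2006, p. 342 L35–36] [cite: Greenberg2010, Lemma 5.2.2 (PDF p. 28 L20–21)]
[cite: Greenberg2016Selmer, §4.3 p. 20 L26–30] -/
theorem loc1_bigRep_of_kappa_ne_one (v : Place K) (σ : absoluteGaloisGroup v.Completion)
    (hσ : κbar (localToUnramified S v σ) ≠ 1) : LOC1 S (bigRep κbar ρ₀) v := by
  intro f hf
  -- the model dual and the coordinates `F` of `f`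
  have hX := isDualPairing_seriesToDual (p := p) (C := DiscreteGaloisModule.UnitsCarrier K) hA bA hYA
  obtain ⟨F, rfl⟩ := hX.bijective.2 f
  have hc0 : (κbar (localToUnramified S v σ)).toAdd ≠ 0 := fun h ↦
    hσ (by rw [← ofAdd_toAdd (κbar (localToUnramified S v σ)), h]; rfl)
  -- adjoints `B` of `ρ₀(σ)` and `U` of the value action of `σ`
  obtain ⟨B, hB⟩ := exists_adjoint hYA (ρ₀ (localToUnramified S v σ))
  obtain ⟨U, hU, hUinj⟩ := exists_valueAdjoint hYA (absGaloisRestrict K v.Completion σ)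
  set MB : Matrix (Fin n) (Fin n) ℤ_[p] := LinearMap.toMatrix bA bA B with hMB
  set MU : Matrix (Fin n) (Fin n) ℤ_[p] := LinearMap.toMatrix bA bA U with hMU
  -- the equivariance in coordinates: `(u • M_B − M_U) *ᵥ F = 0`
  set u : PowerSeries ℤ_[p] := binomSeries ℤ_[p] (-(κbar (localToUnramified S v σ)).toAdd) with hu
  set N : Matrix (Fin n) (Fin n) (PowerSeries ℤ_[p]) :=
    u • MB.map (PowerSeries.C (R := ℤ_[p])) - MU.map (PowerSeries.C (R := ℤ_[p])) with hN
  have hNF : N *ᵥ F = 0 := by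
    have key : u • (MB.map (PowerSeries.C (R := ℤ_[p])) *ᵥ F) = MU.map (PowerSeries.C (R := ℤ_[p])) *ᵥ F := by
      apply hX.injective
      ext Φ
      rw [hX.map_smul, hMB, ← seriesToDual_mapRange bA (ρ₀ (localToUnramified S v σ)) hB F, hMU,
        ← units_seriesToDual bA _ hU F Φ, ← hf σ Φ, localRep_bigRep_eq κbar ρ₀ v σ Φ]
    rw [hN, Matrix.sub_mulVec, Matrix.smul_mulVec, key, sub_self]
  -- `det N ≠ 0`: `N` is the image of `P = w • M_B − M_U ∈ M_n(ℤ_p[w])` under `w ↦ u`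
  let φu : ℤ_[p][X] →+* PowerSeries ℤ_[p] := Polynomial.eval₂RingHom (PowerSeries.C (R := ℤ_[p])) u
  set P : Matrix (Fin n) (Fin n) ℤ_[p][X] :=
    (X : ℤ_[p][X]) • MB.map (Polynomial.C (R := ℤ_[p])) - MU.map (Polynomial.C (R := ℤ_[p])) with hP
  have hPN : φu.mapMatrix P = N := by
    refine Matrix.ext fun i j ↦ ?_
    simp only [RingHom.mapMatrix_apply, Matrix.map_apply, hP, hN, Matrix.sub_apply, Matrix.smul_apply, smul_eq_mul,
      map_sub, φu, Polynomial.coe_eval₂RingHom, Polynomial.eval₂_mul, Polynomial.eval₂_X, Polynomial.eval₂_C]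
  have hdetMU : MU.det ≠ 0 := by
    intro h0
    obtain ⟨x, hx, hMx⟩ := Matrix.exists_mulVec_eq_zero_iff.mpr h0
    apply hx
    have hrepr : x = ⇑(bA.repr (bA.equivFun.symm x)) := by
      funext j; rw [← bA.equivFun_apply, LinearEquiv.apply_symm_apply]
    have hUx : U (bA.equivFun.symm x) = 0 := by
      have := LinearMap.toMatrix_mulVec_repr bA bA U (bA.equivFun.symm x)
      rw [← hMU, ← hrepr, hMx] at this
      have h2 : bA.repr (U (bA.equivFun.symm x)) = 0 := by
        ext j; have := congrFun this j; simpa using this.symm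
      exact bA.repr.map_eq_zero_iff.mp h2
    have : bA.equivFun.symm x = 0 := hUinj (by rw [hUx, map_zero])
    rw [hrepr, this, map_zero]
    rfl
  have hd0 : P.det ≠ 0 := by
    intro h0
    have h := (Polynomial.evalRingHom (0 : ℤ_[p])).map_det P
    rw [h0, map_zero] at h
    have hP0 : (Polynomial.evalRingHom (0 : ℤ_[p])).mapMatrix P = -MU := by
      refine Matrix.ext fun i j ↦ ?_
      simp only [RingHom.mapMatrix_apply, Matrix.map_apply, hP, Matrix.sub_apply, Matrix.smul_apply, smul_eq_mul,
        map_sub, Polynomial.coe_evalRingHom, Polynomial.eval_mul, Polynomial.eval_X, Polynomial.eval_C, zero_mul,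
        zero_sub, Matrix.neg_apply]
    rw [hP0, Matrix.det_neg] at h
    exact hdetMU (by
      have h' := h.symm
      rcases mul_eq_zero.mp h' with h1 | h1
      · exact absurd h1 (pow_ne_zero _ (neg_ne_zero.mpr one_ne_zero))
      · exact h1)
  have hdetN : N.det ≠ 0 := by
    rw [← hPN, ← RingHom.map_det]
    refine eval₂_ne_zero_of_constantCoeff_eq_one hd0 ?_ ?_
    · rw [hu, constantCoeff_binomSeries]
    · rw [hu, coeff_one_binomSeries, Algebra.algebraMap_self_apply, neg_ne_zero]
      exact hc0
  -- hence `F = 0`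
  have hF : F = 0 := by
    by_contra hF
    exact hdetN (Matrix.exists_mulVec_eq_zero_iff.mp ⟨F, hF, hNF⟩)
  rw [hF, map_zero]

end LOC1

end Summit.BirchSwinnertonDyer.BirchSwinnertonDyer.Theorems.P49Kernel

end
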